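import Summits.QuantumFields.YangMills.Theorems.UnitScaleTiltProp7ComplementaryProjectorPointwiseDecay
import HarnessLib

/-!
# Route `UnitScaleTilt`, crux K1 «MinimiserStabilityRegPr» (stmt-QuantumFields-19200), EX face after S45 — **(L3′b) FILE V6: THE POINTWISE KERNEL OF `D_{U₀}(1 − R_{Q″}(U₀))D*_{U₀}` —
# PRINT'S (3.49) PROPER, THE MEMBER SHAPE OF THE EX ROW `h349` — FROM ONE DISPLAYED GRADIENT-COLUMN LETTER** (the gradient twin of px5 g12's V5 ✓`Prop7ComplementaryProjectorPointwiseDecay`;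
# ★p1 g25 CHAIR WORD №7; lead seat `ym-ust-19200-p1` gen 25)

Cell `ym3-torus` (HUMAN RULING D-0037; rung R3 = SU(2) YM₃ on T³ — NOT d = 4, NOT infinite volume, NOT a mass gap, NOT Clay).
THEOREMS ONLY (0 `def`, 0 `sorry`); `--supports stmt-QuantumFields-19200 --as helper`; count-neutral.

WHY.  The EX row `h349` of the S44ᴸγ display reads `‖(toL2⁻¹(D_{U₀}(D*_{U₀}(toL2(δ_b ⊗ Z)) − R_S(U₀)(D*_{U₀}(toL2(δ_b ⊗ Z))))))(bd)‖ ≤ C₃₄₉·ℓ⁻³·e^{−δ₃₄₉·tdist(B b.src, B bd.src)}·‖Z‖`, and under the row's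
Lift antecedent `R_S(U₀) = projR Δ_{U₀} Q″` (✓`Prop7RSEqPrintProjectorOfLift.RS_eq_projR_of_lift`).  So `h349` is the kernel of `D_{U₀} P D*_{U₀}`, `P = 1 − projR Δ_{U₀} Q″` the SMALL-RANK
complementary projector onto `range(G_a Q″†)` (✓`Prop7LODProjectorGlue`), whose columns are the LOD massive columns `ψ_{y,Y} = G_a(Q″†(δ_y ⊗ Y))`.  V5 gave the VALUE kernel of `P` from the
POINTWISE column letter `hcol` (inhabited by ★p1's V4 ✓`Prop7MassiveColumnPointwiseDecay`); THIS file is its gradient twin: routeR-w2's B1 ✓`norm_inner_sub_projR_le` is generic in the two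
test vectors, so testing with the divergences `D*_{U₀}(toL2(δ_{bd} ⊗ W))`, `D*_{U₀}(toL2(δ_b ⊗ Z))` of two bond spikes and moving `D*_{U₀} = D_{U₀}†` (✓`adjoint_DL2`) onto the columns, the
column rows become the GRADIENT-COLUMN LETTER `hDcol : ‖(D_{U₀}ψ_{y,Y})(b)‖_{W₂} ≤ C_g·e^{−κ·tdist(B b.src, y)}·‖Y‖` — the output shape of the (L3′b)-GRAD storey ((G1-0) ✓p761993, (G1-2)
✓p762644, (G1-0′), (G1-3)), DISPLAYED here so that the GRAD knit docks BY NAME.  The pairing's own `c₀` is the `L²(c₀)` normalisation of `δ_{bd} ⊗ W`; the remaining `c₀∕c₁` is print's `η³`.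
WHAT IS PROVED (ns `Summit.QuantumFields.YangMills.Theorems.Prop7ComplementaryProjectorGradientKernel`; letters `hseq hι hT G hAG hGA` of ✓`Prop7ComplementaryProjectorBlockDecay` VERBATIM,
B2c's window∕gap rows at the Gram slope `μ′` VERBATIM as in V5, and the GRADIENT-COLUMN LETTER `hDcol` at rate `κ > μ′`).
* §1 ★ `norm_inner_spike_gradColumn_single_le` — `‖⟪G(T(b_c i)), D*_{U₀}(toL2(δ_{bd} ⊗ W))⟫‖ ≤ c₀(√c₁)⁻¹·C_g·‖W‖_F·e^{−κ·tdist(B bd.src, σ i.1)}` (from `hDcol`, ✓`adjoint_DL2`, ✓`spike_eq_lift`).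
* §2 ★★★ `norm_inner_DstarSingle_sub_projR_DstarSingle_le` — the kernel of `1 − projR` between the two divergences, `≤ (c₀(√c₁)⁻¹C_g‖W‖_F)(c₀(√c₁)⁻¹C_g‖Z‖_F)·C_N(μ′)·(4(2(1+1∕(κ−μ′)))³)²·e^{−μ′·tdist}`.
* §3 ★★ `norm_equiv_DL2_sub_projR_DstarL2_single_le` — THE POINTWISE KERNEL OF `D P D*`:
  `‖(D_{U₀}((1 − projR Δ_{U₀} Q″)(D*_{U₀}(toL2(δ_b ⊗ Z)))))(bd)‖_{W₂} ≤ (c₀∕c₁)·C_g²·C_N(μ′)·(4(2(1+1∕(κ−μ′)))³)²·e^{−μ′·tdist(B bd.src, B b.src)}·‖Z‖_F`.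
HYP-SAT (★★OWNER RULING №42): `RegPr` + the LOD letters (`hseq hι hT` ⟸ ✓`exists_intertwiner_of_regPr` ∕ ✓`inner_adjoint_comp`; `G hAG hGA` ⟸ ✓`Prop7MassivePropagatorCoercive.exists_massive_inverse`),
the window∕gap rows at `μ′` and `hcoer` exactly as V5 (K-free, discharged from `RegPr` for small `μ′` by ✓`Prop7ComplementaryProjectorBlockDecayKnit`'s letters), all on the literal T³ families;
`hDcol` is the ONE displayed letter — the (L3′b)-GRAD storey's target shape (NOT yet inhabited at this writing: (G1-3) is being knit); no `Prop`-valued hypothesis restates the conclusion.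
HONEST SCOPE.  Composition of landed rows; CONDITIONAL on the displayed letters; `h349` itself = THIS §3 + the GRAD knit (inhabiting `hDcol`) + ✓`RS_eq_projR_of_lift` + the `toL2`∕`bondEquiv`
readback + letter arithmetic (`c₁ = c_B = c₀ℓ³`).  Nothing of the ten EX rows, `hT`, `hGF`, EX `stub_existenceMinimalOrbit` or the crux is proved here; the Yang–Mills mass gap is NOT proved.

References: T. Bałaban, CMP **99** (1985) 389–434 [Balaban1985BackgroundPropagators] ((3.8) p.392, (3.11) p.392, (3.21)–(3.25) p.394, Thm 3.1 (3.42) p.397, (3.49) p.399);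
CMP **116** (1988) 1–22 [Balaban1988RG2Cluster] ((2.7) p.13).
-/

set_option autoImplicit false

noncomputable section

open scoped BigOperators Matrix.Norms.L2Operator InnerProductSpace ComplexConjugate Matrix

namespace Summit.QuantumFields.YangMills.Theorems.Prop7ComplementaryProjectorGradientKernel

open Literature.MathematicalPhysics.QuantumFieldTheory.Balaban1983to89
open Finset
open T4Continuum BlockAveraging
open BlockAveraging (Idx)
open B7Prop1Explicit (U1 disp)
open B5Eq118OneStroke (iterBlockOf iterBlock mem_iterBlock card_iterBlock)
open B10Eq27TorusAxialLog (holT transl)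
open B7TransferAnalyticMean (meanCLM)
open B4Sect5Torus (TSite)
open B9Eq311L2Pairing (WL2)
open B11Eq103H1Complex (SiteL2K BondL2K projR)
open Summit.QuantumFields.YangMills.Theorems.Prop8Chart (emlIterU)
open Literature.MathematicalPhysics.QuantumFieldTheory.Balaban1983to89.T3ContinuumYM3Torus
open T3SectALandauChart (eta eta_pos bgUnits)
open T3PrintedRegularMinimiser (RegPr)
open T3PrintedRegularOrbits (sites_eq)
open T3LevelShift (siteShift)
open Summit.QuantumFields.YangMills.Theorems.Prop7SectET3Transport (periodsT3 siteEquiv bondEquiv)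
open Summit.QuantumFields.YangMills.Theorems.Prop7SectET3HilbertLetters (W₂ frobEquiv toL2 toL2S DL2 DstarL2 covLapSite toL2_symm_apply inner_toL2 inner_frobEquiv_symm adjoint_DL2)
open Summit.QuantumFields.YangMills.Theorems.Prop7SpanProjectorGramForm (triple_sum_exp_le)
open Summit.QuantumFields.YangMills.Theorems.Prop7SiteEntryCoordinates (orthonormal_spike top_le_span_spike)
open Summit.QuantumFields.YangMills.Theorems.Prop7BlockDistanceWeights (sum_exp_neg_mul_tdist_coarse_le tdist_coarse_comm tdist_coarse_triangle)
open Summit.QuantumFields.YangMills.Theorems.Prop7ComplementaryProjectorColumns (isUnit_gram_massive_columns norm_inner_sub_projR_le)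
open Summit.QuantumFields.YangMills.Theorems.Prop7CoarseGramInverseDecay (spike_eq_lift norm_gram_inv_spike_le_exp_neg_tdist)
open Summit.QuantumFields.YangMills.Theorems.Prop7TopMeanAdjointBlockLocal (inner_toL2S_single_left)
open Summit.QuantumFields.YangMills.Theorems.Prop7ComplementaryProjectorBlockDecay (sum_exp_neg_mul_dc_spike_le)
open Summit.QuantumFields.YangMills.Theorems.Prop7ComplementaryProjectorPointwiseDecay (norm_spikeEntry_le norm_inner_single_sub_projR_single_le)

variable (F : T3Family) {n K : ℕ} (h : n ≤ K) {c₀ c₁ : ℝ} [Fact (0 < c₀)] [Fact (0 < c₁)]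
  {ε₀ : ℝ} (hε₀ : 0 < ε₀) (hε7 : 10 ^ 7 * (F.L : ℝ) ^ 3 * ε₀ ≤ 1)
  (U₀ : GaugeField (F.P K) 0 (Matrix.specialUnitaryGroup (Fin 2) ℂ)) (hreg : RegPr F n K ε₀ U₀)
  (Q'' : SiteL2K ℂ 3 (periodsT3 F K) c₀ W₂ →ₗ[ℂ] (Site (F.P K) (K - n) → Matrix (Fin 2) (Fin 2) ℂ))
  (hseq : ∀ lam : Site (F.P K) 0 → Matrix (Fin 2) (Fin 2) ℂ, ∃ ns : (j : ℕ) → Site (F.P K) j → Matrix (Fin 2) (Fin 2) ℂ, ns 0 = lam ∧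
      (∀ (j : ℕ) (y : Site (F.P K) (j + 1)), ns (j + 1) y = ns j (emb y) - meanCLM (Idx (F.P K)) (Matrix (Fin 2) (Fin 2) ℂ) fun i : Idx (F.P K) =>
        ns j (emb y) - ((holT (emlIterU j (bgUnits F K U₀)) (emb y) (stairWord i.2.1 (off i.1)) : (Matrix (Fin 2) (Fin 2) ℂ)ˣ) : Matrix (Fin 2) (Fin 2) ℂ) *
          ns j (transl (emb y) (disp (stairWord i.2.1 (off i.1)))) * (((holT (emlIterU j (bgUnits F K U₀)) (emb y) (stairWord i.2.1 (off i.1)))⁻¹ : (Matrix (Fin 2) (Fin 2) ℂ)ˣ) : Matrix (Fin 2) (Fin 2) ℂ)) ∧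
      ns (K - n) = Q'' (toL2S F K c₀ lam))
  (ι : (Site (F.P K) (K - n) → Matrix (Fin 2) (Fin 2) ℂ) →ₗ[ℂ] SiteL2K ℂ 3 (periodsT3 F n) c₁ W₂)
  (hι : ∀ c, ι c = toL2S F n c₁ (fun z => c (siteShift (sites_eq F n K h) z)))
  (T : SiteL2K ℂ 3 (periodsT3 F n) c₁ W₂ →ₗ[ℂ] SiteL2K ℂ 3 (periodsT3 F K) c₀ W₂)
  (hT : ∀ (l : SiteL2K ℂ 3 (periodsT3 F K) c₀ W₂) (f : SiteL2K ℂ 3 (periodsT3 F n) c₁ W₂), ⟪ι (Q'' l), f⟫_ℂ = ⟪l, T f⟫_ℂ)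
  {a : ℝ} (ha : 0 < a)
  (G : SiteL2K ℂ 3 (periodsT3 F K) c₀ W₂ →ₗ[ℂ] SiteL2K ℂ 3 (periodsT3 F K) c₀ W₂)
  (hAG : ∀ f, covLapSite F n K c₀ U₀ (G f) + (a : ℂ) • T (ι (Q'' (G f))) = f)
  (hGA : ∀ u, G (covLapSite F n K c₀ U₀ u + (a : ℂ) • T (ι (Q'' u))) = u)

/-! ## §1 The spike-vs-divergence column row from the gradient-column letter -/

include hι in
/-- ★ **A SPIKE COLUMN AGAINST THE DIVERGENCE OF A BOND SPIKE, FROM THE GRADIENT-COLUMN LETTER**: if every LOD column obeys the POINTWISE GRADIENT row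
`‖(D_{U₀}ψ_{y,Y})(b)‖_{W₂} ≤ C_g·e^{−κ·tdist(B(b.src), y)}·‖Y‖` (`ψ_{y,Y} = G(T(ι(δ_y ⊗ Y)))`), then for the coarse spike basis vector `b_c i = ι(δ_{σ i.1} ⊗ (√c₁)⁻¹E)`:
`‖⟪G(T(b_c i)), D*_{U₀}(toL2(δ_{bd} ⊗ W))⟫‖ ≤ c₀·(√c₁)⁻¹·C_g·‖W‖_F·e^{−κ·tdist(B(bd.src), σ i.1)}` — `D*_{U₀} = D_{U₀}†` (✓`adjoint_DL2`) moves the divergence onto the column, and the pairing with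
`δ_{bd} ⊗ W` is `c₀·tr(Wᴴ(D_{U₀}ψ)(bd)) = c₀⟪W, (D_{U₀}ψ)(bd)⟫_{W₂}` (✓`inner_toL2` at one bond, ✓`inner_frobEquiv_symm`), Cauchy–Schwarz in `W₂`.
[cite: Balaban1985BackgroundPropagators, (3.8) p.392, (3.11) p.392, Thm 3.1 (3.42) p.397] -/
theorem norm_inner_spike_gradColumn_single_le {Cg κ : ℝ} (hCg : 0 ≤ Cg)
    (hDcol : ∀ (y : Site (F.P K) (K - n)) (Y : Matrix (Fin 2) (Fin 2) ℂ) (b : PBond (F.P K) 0),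
      ‖WL2.equiv ℂ _ W₂ (DL2 F n K c₀ U₀ (G (T (ι (Pi.single y Y))))) (bondEquiv F K b)‖ ≤ Cg * Real.exp (-(κ * (Site.tdist (P := F.P K) (iterBlockOf (K - n) b.src) y : ℝ))) * ‖Y‖)
    (i : Site (F.P n) 0 × (Fin 2 × Fin 2)) (bd : PBond (F.P K) 0) (W : Matrix (Fin 2) (Fin 2) ℂ) :
    ‖⟪G (T ((OrthonormalBasis.mk (orthonormal_spike F) (top_le_span_spike F) : OrthonormalBasis (Site (F.P n) 0 × (Fin 2 × Fin 2)) ℂ (SiteL2K ℂ 3 (periodsT3 F n) c₁ W₂)) i)), DstarL2 F n K c₀ U₀ (toL2 F K c₀ (Pi.single bd W))⟫_ℂ‖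
      ≤ c₀ * (Real.sqrt c₁)⁻¹ * Cg * ‖(frobEquiv.symm W : W₂)‖ * Real.exp (-(κ * (Site.tdist (P := F.P K) (iterBlockOf (K - n) bd.src) (siteShift (sites_eq F n K h) i.1) : ℝ))) := by
  have hc₀ : 0 < c₀ := Fact.out
  rw [spike_eq_lift F h ι hι i]
  set Y : Matrix (Fin 2) (Fin 2) ℂ := (((Real.sqrt c₁ : ℝ) : ℂ))⁻¹ • Matrix.single i.2.1 i.2.2 (1 : ℂ) with hY
  set ψ : SiteL2K ℂ 3 (periodsT3 F K) c₀ W₂ := G (T (ι (Pi.single (siteShift (sites_eq F n K h) i.1) Y))) with hψ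
  set v : W₂ := WL2.equiv ℂ _ W₂ (DL2 F n K c₀ U₀ ψ) (bondEquiv F K bd) with hv
  -- a one-bond test field pairs with `toL2 B` through the value of `B` at that bond ((3.11) at one bond)
  have hsingle : ∀ B : PBond (F.P K) 0 → Matrix (Fin 2) (Fin 2) ℂ, ⟪toL2 F K c₀ (Pi.single bd W), toL2 F K c₀ B⟫_ℂ = (c₀ : ℂ) * Matrix.trace (W.conjTranspose * B bd) := by
    intro B
    classical
    rw [inner_toL2, Finset.sum_eq_single bd]
    · rw [Pi.single_eq_same]
    · intro b' _ hb'; rw [Pi.single_eq_of_ne hb', Matrix.conjTranspose_zero, Matrix.zero_mul, Matrix.trace_zero]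
    · intro hbd; exact absurd (Finset.mem_univ bd) hbd
  -- the pairing with the bond spike reads the value of `D_{U₀}ψ` at `bd`
  have hpair : ⟪toL2 F K c₀ (Pi.single bd W), DL2 F n K c₀ U₀ ψ⟫_ℂ = (c₀ : ℂ) * ⟪(frobEquiv.symm W : W₂), v⟫_ℂ := by
    have h1 : DL2 F n K c₀ U₀ ψ = toL2 F K c₀ ((toL2 F K c₀).symm (DL2 F n K c₀ U₀ ψ)) := ((toL2 F K c₀).apply_symm_apply _).symm
    rw [h1, hsingle, toL2_symm_apply, ← inner_frobEquiv_symm, LinearEquiv.symm_apply_apply, hv]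
  have hYn : ‖Y‖ ≤ (Real.sqrt c₁)⁻¹ := norm_spikeEntry_le (c₁ := c₁) i.2.1 i.2.2
  have hvn : ‖v‖ ≤ Cg * Real.exp (-(κ * (Site.tdist (P := F.P K) (iterBlockOf (K - n) bd.src) (siteShift (sites_eq F n K h) i.1) : ℝ))) * (Real.sqrt c₁)⁻¹ :=
    (hDcol _ Y bd).trans (mul_le_mul_of_nonneg_left hYn (mul_nonneg hCg (Real.exp_pos _).le))
  rw [← adjoint_DL2, LinearMap.adjoint_inner_right, ← inner_conj_symm, RCLike.norm_conj, hpair, norm_mul, Complex.norm_real, Real.norm_of_nonneg hc₀.le]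
  calc c₀ * ‖⟪(frobEquiv.symm W : W₂), v⟫_ℂ‖ ≤ c₀ * (‖(frobEquiv.symm W : W₂)‖ * ‖v‖) := mul_le_mul_of_nonneg_left (norm_inner_le_norm _ _) hc₀.le
    _ ≤ c₀ * (‖(frobEquiv.symm W : W₂)‖ * (Cg * Real.exp (-(κ * (Site.tdist (P := F.P K) (iterBlockOf (K - n) bd.src) (siteShift (sites_eq F n K h) i.1) : ℝ))) * (Real.sqrt c₁)⁻¹)) :=
        mul_le_mul_of_nonneg_left (mul_le_mul_of_nonneg_left hvn (norm_nonneg _)) hc₀.le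
    _ = _ := by ring

/-! ## §2 The kernel of `1 − projR` between the divergences of two bond spikes -/
include hε₀ hε7 hreg hseq hι hT ha hAG hGA in
set_option maxHeartbeats 400000 in
-- hb: the statement carries B2c's closed-form Gram constant twice (README №24 class, as ✓`norm_inner_sub_projR_blocks_le`).
/-- ★★★ **THE KERNEL OF PRINT'S COMPLEMENTARY GAUGE PROJECTOR BETWEEN THE DIVERGENCES OF TWO BOND SPIKES** (px5 g12's ✓`norm_inner_single_sub_projR_single_le` with the test vectors
`D*_{U₀}(toL2(δ_{bd} ⊗ W))`, `D*_{U₀}(toL2(δ_b ⊗ Z))` — routeR-w2's B1 ✓`norm_inner_sub_projR_le` is generic in the two test vectors).  For bonds `bd, b`, matrices `W, Z`, a Gram slope `μ′ ≥ 0`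
carrying B2c's window∕gap rows (`hδ`, `hwin`, `hgap`), `‖ι(Q″λ)‖ ≤ C_T‖λ‖`, `‖G‖ ≤ C_G`, the coarse coercivity `m_B‖f‖ ≤ ‖G(Tf)‖`, and the GRADIENT COLUMN LETTER `hDcol` at a rate `κ > μ′`:
`‖⟪D*_{U₀}(toL2(δ_{bd} ⊗ W)), (1 − projR Δ_{U₀} Q″)(D*_{U₀}(toL2(δ_b ⊗ Z)))⟫‖ ≤ (c₀(√c₁)⁻¹C_g‖W‖_F)·(c₀(√c₁)⁻¹C_g‖Z‖_F)·C_N(μ′)·(4(2(1 + 1∕(κ−μ′)))³)²·e^{−μ′·tdist(B bd.src, B b.src)}`,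
`C_N(μ′) = (m_B²∕2 − 3ε(μ′)²)⁻¹e^{9μ′}` — B1 in the coarse spike basis, §1 twice, B2c ✓`norm_gram_inv_spike_le_exp_neg_tdist`, ✓`triple_sum_exp_le`.
[cite: Balaban1985BackgroundPropagators, (3.8) p.392, Thm 3.1 (3.42) p.397, (3.49) p.399; Balaban1988RG2Cluster, (2.7) p.13] -/
theorem norm_inner_DstarSingle_sub_projR_DstarSingle_le {μ' κ : ℝ} (hμ' : 0 ≤ μ') (hμ'κ : μ' < κ)
    {δ₁ : ℝ} (hδ₁ : 0 ≤ δ₁)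
    (hδ : 3 * ((eta F n K)⁻¹) ^ 2 * (Real.exp (μ' * eta F n K) - 1) ^ 2 + a * ((25 / 8) * (c₁ * ((((F.P K).L : ℝ) ^ (F.P K).d) ^ (K - n))⁻¹ / c₀)) * (Real.exp (3 * μ') - 1) ^ 2 ≤ δ₁ ^ 2)
    (hwin : Real.sqrt (max 2 (16 * c₀ * ((F.L : ℝ) ^ (K - n)) ^ 3 / (a * c₁))) * δ₁ ≤ 1 / 10)
    {CT : ℝ} (hCT : 0 ≤ CT) (hCTb : ∀ l : SiteL2K ℂ 3 (periodsT3 F K) c₀ W₂, ‖ι (Q'' l)‖ ≤ CT * ‖l‖)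
    {CG : ℝ} (hCG : 0 ≤ CG) (hGn : ∀ f, ‖G f‖ ≤ CG * ‖f‖)
    {mB : ℝ} (hmB : 0 < mB) (hcoer : ∀ f : SiteL2K ℂ 3 (periodsT3 F n) c₁ W₂, mB * ‖f‖ ≤ ‖G (T f)‖)
    (hgap : 3 * ((Real.sqrt (max 2 (16 * c₀ * ((F.L : ℝ) ^ (K - n)) ^ 3 / (a * c₁))) * (2 + Real.sqrt (max 2 (16 * c₀ * ((F.L : ℝ) ^ (K - n)) ^ 3 / (a * c₁)))))
          * (Real.sqrt 3 * (eta F n K)⁻¹ * (Real.exp (μ' * eta F n K) - 1) + (Real.sqrt 3 * (eta F n K)⁻¹ * (Real.exp (μ' * eta F n K) - 1)) ^ 2 + Real.sqrt a * CT * (Real.exp (3 * μ') - 1) + a * CT ^ 2 * (Real.exp (3 * μ') - 1) ^ 2)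
          * (8 * Real.sqrt (max 2 (16 * c₀ * ((F.L : ℝ) ^ (K - n)) ^ 3 / (a * c₁))) + 8 * Real.sqrt (max 2 (16 * c₀ * ((F.L : ℝ) ^ (K - n)) ^ 3 / (a * c₁))) ^ 2)
          * (CT * (1 + (Real.exp (3 * μ') - 1))) + CG * (CT * (Real.exp (3 * μ') - 1))) ^ 2 < mB ^ 2 / 2)
    {Cg : ℝ} (hCg : 0 ≤ Cg)
    (hDcol : ∀ (y : Site (F.P K) (K - n)) (Y : Matrix (Fin 2) (Fin 2) ℂ) (b : PBond (F.P K) 0),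
      ‖WL2.equiv ℂ _ W₂ (DL2 F n K c₀ U₀ (G (T (ι (Pi.single y Y))))) (bondEquiv F K b)‖ ≤ Cg * Real.exp (-(κ * (Site.tdist (P := F.P K) (iterBlockOf (K - n) b.src) y : ℝ))) * ‖Y‖)
    (bd b : PBond (F.P K) 0) (W Z : Matrix (Fin 2) (Fin 2) ℂ) :
    ‖⟪DstarL2 F n K c₀ U₀ (toL2 F K c₀ (Pi.single bd W)), DstarL2 F n K c₀ U₀ (toL2 F K c₀ (Pi.single b Z)) - projR (covLapSite F n K c₀ U₀) Q'' (DstarL2 F n K c₀ U₀ (toL2 F K c₀ (Pi.single b Z)))⟫_ℂ‖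
      ≤ (c₀ * (Real.sqrt c₁)⁻¹ * Cg * ‖(frobEquiv.symm W : W₂)‖)
        * (c₀ * (Real.sqrt c₁)⁻¹ * Cg * ‖(frobEquiv.symm Z : W₂)‖)
        * ((mB ^ 2 / 2 - 3 * ((Real.sqrt (max 2 (16 * c₀ * ((F.L : ℝ) ^ (K - n)) ^ 3 / (a * c₁))) * (2 + Real.sqrt (max 2 (16 * c₀ * ((F.L : ℝ) ^ (K - n)) ^ 3 / (a * c₁)))))
          * (Real.sqrt 3 * (eta F n K)⁻¹ * (Real.exp (μ' * eta F n K) - 1) + (Real.sqrt 3 * (eta F n K)⁻¹ * (Real.exp (μ' * eta F n K) - 1)) ^ 2 + Real.sqrt a * CT * (Real.exp (3 * μ') - 1) + a * CT ^ 2 * (Real.exp (3 * μ') - 1) ^ 2)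
          * (8 * Real.sqrt (max 2 (16 * c₀ * ((F.L : ℝ) ^ (K - n)) ^ 3 / (a * c₁))) + 8 * Real.sqrt (max 2 (16 * c₀ * ((F.L : ℝ) ^ (K - n)) ^ 3 / (a * c₁))) ^ 2)
          * (CT * (1 + (Real.exp (3 * μ') - 1))) + CG * (CT * (Real.exp (3 * μ') - 1))) ^ 2)⁻¹ * Real.exp (9 * μ'))
        * (4 * (2 * (1 + 1 / (κ - μ'))) ^ 3) ^ 2
        * Real.exp (-(μ' * (Site.tdist (P := F.P K) (iterBlockOf (K - n) bd.src) (iterBlockOf (K - n) b.src) : ℝ))) := by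
  classical
  have hc₀ : 0 < c₀ := Fact.out
  have hc₁ : 0 < c₁ := Fact.out
  have hunit := isUnit_gram_massive_columns F T G (OrthonormalBasis.mk (orthonormal_spike F) (top_le_span_spike F) : OrthonormalBasis (Site (F.P n) 0 × (Fin 2 × Fin 2)) ℂ (SiteL2K ℂ 3 (periodsT3 F n) c₁ W₂)) hmB hcoer
  -- the two gradient-column rows (§1), read at the blocks of `bd.src`, `b.src`
  have hA : ∀ i : Site (F.P n) 0 × (Fin 2 × Fin 2), ‖⟪G (T ((OrthonormalBasis.mk (orthonormal_spike F) (top_le_span_spike F) : OrthonormalBasis (Site (F.P n) 0 × (Fin 2 × Fin 2)) ℂ (SiteL2K ℂ 3 (periodsT3 F n) c₁ W₂)) i)), DstarL2 F n K c₀ U₀ (toL2 F K c₀ (Pi.single bd W))⟫_ℂ‖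
      ≤ c₀ * (Real.sqrt c₁)⁻¹ * Cg * ‖(frobEquiv.symm W : W₂)‖ * Real.exp (-(κ * (Site.tdist (P := F.P K) (iterBlockOf (K - n) bd.src) (siteShift (sites_eq F n K h) i.1) : ℝ))) :=
    fun i => norm_inner_spike_gradColumn_single_le F h U₀ ι hι T G hCg hDcol i bd W
  have hB : ∀ i' : Site (F.P n) 0 × (Fin 2 × Fin 2), ‖⟪G (T ((OrthonormalBasis.mk (orthonormal_spike F) (top_le_span_spike F) : OrthonormalBasis (Site (F.P n) 0 × (Fin 2 × Fin 2)) ℂ (SiteL2K ℂ 3 (periodsT3 F n) c₁ W₂)) i')), DstarL2 F n K c₀ U₀ (toL2 F K c₀ (Pi.single b Z))⟫_ℂ‖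
      ≤ c₀ * (Real.sqrt c₁)⁻¹ * Cg * ‖(frobEquiv.symm Z : W₂)‖ * Real.exp (-(κ * (Site.tdist (P := F.P K) (iterBlockOf (K - n) b.src) (siteShift (sites_eq F n K h) i'.1) : ℝ))) :=
    fun i' => norm_inner_spike_gradColumn_single_le F h U₀ ι hι T G hCg hDcol i' b Z
  have hP := norm_inner_sub_projR_le F h U₀ Q'' ι hι T hT G hAG hGA (OrthonormalBasis.mk (orthonormal_spike F) (top_le_span_spike F) : OrthonormalBasis (Site (F.P n) 0 × (Fin 2 × Fin 2)) ℂ (SiteL2K ℂ 3 (periodsT3 F n) c₁ W₂)) hunit (DstarL2 F n K c₀ U₀ (toL2 F K c₀ (Pi.single bd W))) (DstarL2 F n K c₀ U₀ (toL2 F K c₀ (Pi.single b Z))) _ _ hA hB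
  refine hP.trans ?_
  -- the inverse Gram decay at slope `μ′` (B2c)
  have hN : ∀ i i' : Site (F.P n) 0 × (Fin 2 × Fin 2),
      ‖(Matrix.of fun i i' : Site (F.P n) 0 × (Fin 2 × Fin 2) => ⟪G (T ((OrthonormalBasis.mk (orthonormal_spike F) (top_le_span_spike F) : OrthonormalBasis (Site (F.P n) 0 × (Fin 2 × Fin 2)) ℂ (SiteL2K ℂ 3 (periodsT3 F n) c₁ W₂)) i)), G (T ((OrthonormalBasis.mk (orthonormal_spike F) (top_le_span_spike F) : OrthonormalBasis (Site (F.P n) 0 × (Fin 2 × Fin 2)) ℂ (SiteL2K ℂ 3 (periodsT3 F n) c₁ W₂)) i'))⟫_ℂ)⁻¹ i i'‖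
        ≤ ((mB ^ 2 / 2 - 3 * ((Real.sqrt (max 2 (16 * c₀ * ((F.L : ℝ) ^ (K - n)) ^ 3 / (a * c₁))) * (2 + Real.sqrt (max 2 (16 * c₀ * ((F.L : ℝ) ^ (K - n)) ^ 3 / (a * c₁)))))
          * (Real.sqrt 3 * (eta F n K)⁻¹ * (Real.exp (μ' * eta F n K) - 1) + (Real.sqrt 3 * (eta F n K)⁻¹ * (Real.exp (μ' * eta F n K) - 1)) ^ 2 + Real.sqrt a * CT * (Real.exp (3 * μ') - 1) + a * CT ^ 2 * (Real.exp (3 * μ') - 1) ^ 2)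
          * (8 * Real.sqrt (max 2 (16 * c₀ * ((F.L : ℝ) ^ (K - n)) ^ 3 / (a * c₁))) + 8 * Real.sqrt (max 2 (16 * c₀ * ((F.L : ℝ) ^ (K - n)) ^ 3 / (a * c₁))) ^ 2)
          * (CT * (1 + (Real.exp (3 * μ') - 1))) + CG * (CT * (Real.exp (3 * μ') - 1))) ^ 2)⁻¹ * Real.exp (9 * μ')) * Real.exp (-(μ' * (fun i j : Site (F.P n) 0 × (Fin 2 × Fin 2) => (Site.tdist (P := F.P K) (siteShift (sites_eq F n K h) i.1) (siteShift (sites_eq F n K h) j.1) : ℝ)) i i')) :=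
    fun i i' => norm_gram_inv_spike_le_exp_neg_tdist F h hε₀ hε7 U₀ hreg Q'' hseq ι hι T hT ha G hAG hμ' hδ₁ hδ hwin hCT hCTb hCG hGn hmB hcoer hgap i i'
  -- the pseudo-metric and the volume
  have hds : ∀ i j : Site (F.P n) 0 × (Fin 2 × Fin 2), (fun i j : Site (F.P n) 0 × (Fin 2 × Fin 2) => (Site.tdist (P := F.P K) (siteShift (sites_eq F n K h) i.1) (siteShift (sites_eq F n K h) j.1) : ℝ)) i j = (fun i j : Site (F.P n) 0 × (Fin 2 × Fin 2) => (Site.tdist (P := F.P K) (siteShift (sites_eq F n K h) i.1) (siteShift (sites_eq F n K h) j.1) : ℝ)) j i := fun i j => tdist_coarse_comm F _ _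
  have hdt : ∀ i j k : Site (F.P n) 0 × (Fin 2 × Fin 2), (fun i j : Site (F.P n) 0 × (Fin 2 × Fin 2) => (Site.tdist (P := F.P K) (siteShift (sites_eq F n K h) i.1) (siteShift (sites_eq F n K h) j.1) : ℝ)) i k ≤ (fun i j : Site (F.P n) 0 × (Fin 2 × Fin 2) => (Site.tdist (P := F.P K) (siteShift (sites_eq F n K h) i.1) (siteShift (sites_eq F n K h) j.1) : ℝ)) i j + (fun i j : Site (F.P n) 0 × (Fin 2 × Fin 2) => (Site.tdist (P := F.P K) (siteShift (sites_eq F n K h) i.1) (siteShift (sites_eq F n K h) j.1) : ℝ)) j k := fun i j k => tdist_coarse_triangle F _ _ _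
  have hν : 0 < κ - μ' := sub_pos.2 hμ'κ
  have hvol' : ∀ i₀ : Site (F.P n) 0 × (Fin 2 × Fin 2),
      ∑ i : Site (F.P n) 0 × (Fin 2 × Fin 2), Real.exp (-((κ - μ') * (fun i j : Site (F.P n) 0 × (Fin 2 × Fin 2) => (Site.tdist (P := F.P K) (siteShift (sites_eq F n K h) i.1) (siteShift (sites_eq F n K h) j.1) : ℝ)) i i₀)) ≤ 4 * (2 * (1 + 1 / (κ - μ'))) ^ 3 :=
    fun i₀ => sum_exp_neg_mul_dc_spike_le F h hν i₀
  have hC₁ : 0 ≤ c₀ * (Real.sqrt c₁)⁻¹ * Cg * ‖(frobEquiv.symm W : W₂)‖ := by positivity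
  have hC₂ : 0 ≤ c₀ * (Real.sqrt c₁)⁻¹ * Cg * ‖(frobEquiv.symm Z : W₂)‖ := by positivity
  have hCN : 0 ≤ ((mB ^ 2 / 2 - 3 * ((Real.sqrt (max 2 (16 * c₀ * ((F.L : ℝ) ^ (K - n)) ^ 3 / (a * c₁))) * (2 + Real.sqrt (max 2 (16 * c₀ * ((F.L : ℝ) ^ (K - n)) ^ 3 / (a * c₁)))))
          * (Real.sqrt 3 * (eta F n K)⁻¹ * (Real.exp (μ' * eta F n K) - 1) + (Real.sqrt 3 * (eta F n K)⁻¹ * (Real.exp (μ' * eta F n K) - 1)) ^ 2 + Real.sqrt a * CT * (Real.exp (3 * μ') - 1) + a * CT ^ 2 * (Real.exp (3 * μ') - 1) ^ 2)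
          * (8 * Real.sqrt (max 2 (16 * c₀ * ((F.L : ℝ) ^ (K - n)) ^ 3 / (a * c₁))) + 8 * Real.sqrt (max 2 (16 * c₀ * ((F.L : ℝ) ^ (K - n)) ^ 3 / (a * c₁))) ^ 2)
          * (CT * (1 + (Real.exp (3 * μ') - 1))) + CG * (CT * (Real.exp (3 * μ') - 1))) ^ 2)⁻¹ * Real.exp (9 * μ')) :=
    mul_nonneg (le_of_lt (inv_pos.2 (sub_pos.2 hgap))) (Real.exp_pos _).le
  have h3 := triple_sum_exp_le (fun i j : Site (F.P n) 0 × (Fin 2 × Fin 2) => (Site.tdist (P := F.P K) (siteShift (sites_eq F n K h) i.1) (siteShift (sites_eq F n K h) j.1) : ℝ)) hds hdt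
    (fun i : Site (F.P n) 0 × (Fin 2 × Fin 2) => c₀ * (Real.sqrt c₁)⁻¹ * Cg * ‖(frobEquiv.symm W : W₂)‖
      * Real.exp (-(κ * (Site.tdist (P := F.P K) (iterBlockOf (K - n) bd.src) (siteShift (sites_eq F n K h) i.1) : ℝ))))
    (fun i' : Site (F.P n) 0 × (Fin 2 × Fin 2) => c₀ * (Real.sqrt c₁)⁻¹ * Cg * ‖(frobEquiv.symm Z : W₂)‖
      * Real.exp (-(κ * (Site.tdist (P := F.P K) (iterBlockOf (K - n) b.src) (siteShift (sites_eq F n K h) i'.1) : ℝ))))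
    (fun i i' => ‖(Matrix.of fun i i' : Site (F.P n) 0 × (Fin 2 × Fin 2) => ⟪G (T ((OrthonormalBasis.mk (orthonormal_spike F) (top_le_span_spike F) : OrthonormalBasis (Site (F.P n) 0 × (Fin 2 × Fin 2)) ℂ (SiteL2K ℂ 3 (periodsT3 F n) c₁ W₂)) i)), G (T ((OrthonormalBasis.mk (orthonormal_spike F) (top_le_span_spike F) : OrthonormalBasis (Site (F.P n) 0 × (Fin 2 × Fin 2)) ℂ (SiteL2K ℂ 3 (periodsT3 F n) c₁ W₂)) i'))⟫_ℂ)⁻¹ i i'‖)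
    hC₁ hC₂ hCN hμ' (fun i' => (hB i').trans' (norm_nonneg _)) (fun _ _ => norm_nonneg _)
    ((siteShift (sites_eq F n K h)).symm (iterBlockOf (K - n) bd.src), ((0 : Fin 2), (0 : Fin 2))) ((siteShift (sites_eq F n K h)).symm (iterBlockOf (K - n) b.src), ((0 : Fin 2), (0 : Fin 2)))
    (fun i => by simp only [Equiv.apply_symm_apply]; exact le_rfl) (fun i' => by simp only [Equiv.apply_symm_apply]; exact le_rfl) hN hvol'
  simp only [Equiv.apply_symm_apply] at h3
  exact h3

/-! ## §3 The pointwise kernel of `D P D*` — h349's member shape -/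
include hε₀ hε7 hreg hseq hι hT ha hAG hGA in
set_option maxHeartbeats 400000 in
-- hb: as §2 (the closed-form Gram constant in the statement).
/-- ★★ **THE POINTWISE KERNEL OF `D_{U₀}(1 − R_{Q″}(U₀))D*_{U₀}`** (print's (3.49) proper — h349's MEMBER SHAPE, with its `η³`): under the letters of §2,
`‖(D_{U₀}((1 − projR Δ_{U₀} Q″)(D*_{U₀}(toL2(δ_b ⊗ Z)))))(bd)‖_{W₂} ≤ (c₀∕c₁)·C_g²·C_N(μ′)·(4(2(1 + 1∕(κ−μ′)))³)²·e^{−μ′·tdist(B bd.src, B b.src)}·‖Z‖_F` — §2 tested against the bond spike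
`δ_{bd} ⊗ (D P D* δ_b Z)(bd)` (`⟪D*_{U₀}(toL2(δ_{bd} ⊗ W)), g⟫ = ⟪toL2(δ_{bd} ⊗ W), D_{U₀}g⟫ = c₀⟪W, (D_{U₀}g)(bd)⟫_{W₂}`, ✓`adjoint_DL2`), divided by `c₀‖(D_{U₀}g)(bd)‖`.  At the pin `c₁ = c₀ℓ³`:
`c₀∕c₁ = η³` = h349's `((L : ℝ) ^ (K − n))⁻¹ ^ 3`. [cite: Balaban1985BackgroundPropagators, Thm 3.1 (3.42) p.397, (3.49) p.399] -/
theorem norm_equiv_DL2_sub_projR_DstarL2_single_le {μ' κ : ℝ} (hμ' : 0 ≤ μ') (hμ'κ : μ' < κ)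
    {δ₁ : ℝ} (hδ₁ : 0 ≤ δ₁)
    (hδ : 3 * ((eta F n K)⁻¹) ^ 2 * (Real.exp (μ' * eta F n K) - 1) ^ 2 + a * ((25 / 8) * (c₁ * ((((F.P K).L : ℝ) ^ (F.P K).d) ^ (K - n))⁻¹ / c₀)) * (Real.exp (3 * μ') - 1) ^ 2 ≤ δ₁ ^ 2)
    (hwin : Real.sqrt (max 2 (16 * c₀ * ((F.L : ℝ) ^ (K - n)) ^ 3 / (a * c₁))) * δ₁ ≤ 1 / 10)
    {CT : ℝ} (hCT : 0 ≤ CT) (hCTb : ∀ l : SiteL2K ℂ 3 (periodsT3 F K) c₀ W₂, ‖ι (Q'' l)‖ ≤ CT * ‖l‖)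
    {CG : ℝ} (hCG : 0 ≤ CG) (hGn : ∀ f, ‖G f‖ ≤ CG * ‖f‖)
    {mB : ℝ} (hmB : 0 < mB) (hcoer : ∀ f : SiteL2K ℂ 3 (periodsT3 F n) c₁ W₂, mB * ‖f‖ ≤ ‖G (T f)‖)
    (hgap : 3 * ((Real.sqrt (max 2 (16 * c₀ * ((F.L : ℝ) ^ (K - n)) ^ 3 / (a * c₁))) * (2 + Real.sqrt (max 2 (16 * c₀ * ((F.L : ℝ) ^ (K - n)) ^ 3 / (a * c₁)))))
          * (Real.sqrt 3 * (eta F n K)⁻¹ * (Real.exp (μ' * eta F n K) - 1) + (Real.sqrt 3 * (eta F n K)⁻¹ * (Real.exp (μ' * eta F n K) - 1)) ^ 2 + Real.sqrt a * CT * (Real.exp (3 * μ') - 1) + a * CT ^ 2 * (Real.exp (3 * μ') - 1) ^ 2)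
          * (8 * Real.sqrt (max 2 (16 * c₀ * ((F.L : ℝ) ^ (K - n)) ^ 3 / (a * c₁))) + 8 * Real.sqrt (max 2 (16 * c₀ * ((F.L : ℝ) ^ (K - n)) ^ 3 / (a * c₁))) ^ 2)
          * (CT * (1 + (Real.exp (3 * μ') - 1))) + CG * (CT * (Real.exp (3 * μ') - 1))) ^ 2 < mB ^ 2 / 2)
    {Cg : ℝ} (hCg : 0 ≤ Cg)
    (hDcol : ∀ (y : Site (F.P K) (K - n)) (Y : Matrix (Fin 2) (Fin 2) ℂ) (b : PBond (F.P K) 0),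
      ‖WL2.equiv ℂ _ W₂ (DL2 F n K c₀ U₀ (G (T (ι (Pi.single y Y))))) (bondEquiv F K b)‖ ≤ Cg * Real.exp (-(κ * (Site.tdist (P := F.P K) (iterBlockOf (K - n) b.src) y : ℝ))) * ‖Y‖)
    (bd b : PBond (F.P K) 0) (Z : Matrix (Fin 2) (Fin 2) ℂ) :
    ‖WL2.equiv ℂ _ W₂ (DL2 F n K c₀ U₀ (DstarL2 F n K c₀ U₀ (toL2 F K c₀ (Pi.single b Z)) - projR (covLapSite F n K c₀ U₀) Q'' (DstarL2 F n K c₀ U₀ (toL2 F K c₀ (Pi.single b Z))))) (bondEquiv F K bd)‖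
      ≤ (c₀ / c₁) * Cg ^ 2 * ((mB ^ 2 / 2 - 3 * ((Real.sqrt (max 2 (16 * c₀ * ((F.L : ℝ) ^ (K - n)) ^ 3 / (a * c₁))) * (2 + Real.sqrt (max 2 (16 * c₀ * ((F.L : ℝ) ^ (K - n)) ^ 3 / (a * c₁)))))
          * (Real.sqrt 3 * (eta F n K)⁻¹ * (Real.exp (μ' * eta F n K) - 1) + (Real.sqrt 3 * (eta F n K)⁻¹ * (Real.exp (μ' * eta F n K) - 1)) ^ 2 + Real.sqrt a * CT * (Real.exp (3 * μ') - 1) + a * CT ^ 2 * (Real.exp (3 * μ') - 1) ^ 2)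
          * (8 * Real.sqrt (max 2 (16 * c₀ * ((F.L : ℝ) ^ (K - n)) ^ 3 / (a * c₁))) + 8 * Real.sqrt (max 2 (16 * c₀ * ((F.L : ℝ) ^ (K - n)) ^ 3 / (a * c₁))) ^ 2)
          * (CT * (1 + (Real.exp (3 * μ') - 1))) + CG * (CT * (Real.exp (3 * μ') - 1))) ^ 2)⁻¹ * Real.exp (9 * μ'))
        * (4 * (2 * (1 + 1 / (κ - μ'))) ^ 3) ^ 2
        * Real.exp (-(μ' * (Site.tdist (P := F.P K) (iterBlockOf (K - n) bd.src) (iterBlockOf (K - n) b.src) : ℝ))) * ‖(frobEquiv.symm Z : W₂)‖ := by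
  have hc₀ : 0 < c₀ := Fact.out
  have hc₁ : 0 < c₁ := Fact.out
  -- a one-bond test field pairs with `toL2 B` through the value of `B` at that bond ((3.11) at one bond)
  have hsingle : ∀ (E : Matrix (Fin 2) (Fin 2) ℂ) (B : PBond (F.P K) 0 → Matrix (Fin 2) (Fin 2) ℂ),
      ⟪toL2 F K c₀ (Pi.single bd E), toL2 F K c₀ B⟫_ℂ = (c₀ : ℂ) * Matrix.trace (E.conjTranspose * B bd) := by
    intro E B
    classical
    rw [inner_toL2, Finset.sum_eq_single bd]
    · rw [Pi.single_eq_same]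
    · intro b' _ hb'; rw [Pi.single_eq_of_ne hb', Matrix.conjTranspose_zero, Matrix.zero_mul, Matrix.trace_zero]
    · intro hbd; exact absurd (Finset.mem_univ bd) hbd
  set g : SiteL2K ℂ 3 (periodsT3 F K) c₀ W₂ := DstarL2 F n K c₀ U₀ (toL2 F K c₀ (Pi.single b Z)) - projR (covLapSite F n K c₀ U₀) Q'' (DstarL2 F n K c₀ U₀ (toL2 F K c₀ (Pi.single b Z))) with hg
  set v : W₂ := WL2.equiv ℂ _ W₂ (DL2 F n K c₀ U₀ g) (bondEquiv F K bd) with hv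
  have hWv : (frobEquiv.symm (frobEquiv v) : W₂) = v := LinearEquiv.symm_apply_apply _ _
  -- the bond-spike test: `⟪D*_{U₀}(toL2(δ_{bd} ⊗ frobEquiv v)), g⟫ = ⟪toL2(δ_{bd} ⊗ frobEquiv v), D_{U₀}g⟫ = c₀‖v‖²`
  have hpair : ⟪DstarL2 F n K c₀ U₀ (toL2 F K c₀ (Pi.single bd (frobEquiv v))), g⟫_ℂ = (c₀ : ℂ) * ⟪v, v⟫_ℂ := by
    rw [← adjoint_DL2, LinearMap.adjoint_inner_left]
    have h1 : DL2 F n K c₀ U₀ g = toL2 F K c₀ ((toL2 F K c₀).symm (DL2 F n K c₀ U₀ g)) := ((toL2 F K c₀).apply_symm_apply _).symm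
    rw [h1, hsingle, toL2_symm_apply, ← inner_frobEquiv_symm, LinearEquiv.symm_apply_apply]
  have hnorm : ‖⟪DstarL2 F n K c₀ U₀ (toL2 F K c₀ (Pi.single bd (frobEquiv v))), g⟫_ℂ‖ = c₀ * ‖v‖ ^ 2 := by
    rw [hpair, norm_mul, Complex.norm_real, Real.norm_of_nonneg hc₀.le, inner_self_eq_norm_sq_to_K, norm_pow, RCLike.norm_ofReal, abs_norm]
  -- §2 against this test field
  have h2 := norm_inner_DstarSingle_sub_projR_DstarSingle_le F h hε₀ hε7 U₀ hreg Q'' hseq ι hι T hT ha G hAG hGA hμ' hμ'κ hδ₁ hδ hwin hCT hCTb hCG hGn hmB hcoer hgap hCg hDcol bd b (frobEquiv v) Z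
  rw [← hg, hnorm, hWv] at h2
  -- abbreviate the constant
  have hCN : 0 ≤ ((mB ^ 2 / 2 - 3 * ((Real.sqrt (max 2 (16 * c₀ * ((F.L : ℝ) ^ (K - n)) ^ 3 / (a * c₁))) * (2 + Real.sqrt (max 2 (16 * c₀ * ((F.L : ℝ) ^ (K - n)) ^ 3 / (a * c₁)))))
          * (Real.sqrt 3 * (eta F n K)⁻¹ * (Real.exp (μ' * eta F n K) - 1) + (Real.sqrt 3 * (eta F n K)⁻¹ * (Real.exp (μ' * eta F n K) - 1)) ^ 2 + Real.sqrt a * CT * (Real.exp (3 * μ') - 1) + a * CT ^ 2 * (Real.exp (3 * μ') - 1) ^ 2)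
          * (8 * Real.sqrt (max 2 (16 * c₀ * ((F.L : ℝ) ^ (K - n)) ^ 3 / (a * c₁))) + 8 * Real.sqrt (max 2 (16 * c₀ * ((F.L : ℝ) ^ (K - n)) ^ 3 / (a * c₁))) ^ 2)
          * (CT * (1 + (Real.exp (3 * μ') - 1))) + CG * (CT * (Real.exp (3 * μ') - 1))) ^ 2)⁻¹ * Real.exp (9 * μ')) :=
    mul_nonneg (le_of_lt (inv_pos.2 (sub_pos.2 hgap))) (Real.exp_pos _).le
  have hK0 : 0 ≤ (c₀ / c₁) * Cg ^ 2 * ((mB ^ 2 / 2 - 3 * ((Real.sqrt (max 2 (16 * c₀ * ((F.L : ℝ) ^ (K - n)) ^ 3 / (a * c₁))) * (2 + Real.sqrt (max 2 (16 * c₀ * ((F.L : ℝ) ^ (K - n)) ^ 3 / (a * c₁)))))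
          * (Real.sqrt 3 * (eta F n K)⁻¹ * (Real.exp (μ' * eta F n K) - 1) + (Real.sqrt 3 * (eta F n K)⁻¹ * (Real.exp (μ' * eta F n K) - 1)) ^ 2 + Real.sqrt a * CT * (Real.exp (3 * μ') - 1) + a * CT ^ 2 * (Real.exp (3 * μ') - 1) ^ 2)
          * (8 * Real.sqrt (max 2 (16 * c₀ * ((F.L : ℝ) ^ (K - n)) ^ 3 / (a * c₁))) + 8 * Real.sqrt (max 2 (16 * c₀ * ((F.L : ℝ) ^ (K - n)) ^ 3 / (a * c₁))) ^ 2)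
          * (CT * (1 + (Real.exp (3 * μ') - 1))) + CG * (CT * (Real.exp (3 * μ') - 1))) ^ 2)⁻¹ * Real.exp (9 * μ'))
        * (4 * (2 * (1 + 1 / (κ - μ'))) ^ 3) ^ 2
        * Real.exp (-(μ' * (Site.tdist (P := F.P K) (iterBlockOf (K - n) bd.src) (iterBlockOf (K - n) b.src) : ℝ))) * ‖(frobEquiv.symm Z : W₂)‖ :=
    mul_nonneg (mul_nonneg (mul_nonneg (mul_nonneg (by positivity) hCN) (by positivity)) (Real.exp_pos _).le) (norm_nonneg _)
  set M : ℝ := ((mB ^ 2 / 2 - 3 * ((Real.sqrt (max 2 (16 * c₀ * ((F.L : ℝ) ^ (K - n)) ^ 3 / (a * c₁))) * (2 + Real.sqrt (max 2 (16 * c₀ * ((F.L : ℝ) ^ (K - n)) ^ 3 / (a * c₁)))))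
          * (Real.sqrt 3 * (eta F n K)⁻¹ * (Real.exp (μ' * eta F n K) - 1) + (Real.sqrt 3 * (eta F n K)⁻¹ * (Real.exp (μ' * eta F n K) - 1)) ^ 2 + Real.sqrt a * CT * (Real.exp (3 * μ') - 1) + a * CT ^ 2 * (Real.exp (3 * μ') - 1) ^ 2)
          * (8 * Real.sqrt (max 2 (16 * c₀ * ((F.L : ℝ) ^ (K - n)) ^ 3 / (a * c₁))) + 8 * Real.sqrt (max 2 (16 * c₀ * ((F.L : ℝ) ^ (K - n)) ^ 3 / (a * c₁))) ^ 2)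
          * (CT * (1 + (Real.exp (3 * μ') - 1))) + CG * (CT * (Real.exp (3 * μ') - 1))) ^ 2)⁻¹ * Real.exp (9 * μ')) * (4 * (2 * (1 + 1 / (κ - μ'))) ^ 3) ^ 2
      * Real.exp (-(μ' * (Site.tdist (P := F.P K) (iterBlockOf (K - n) bd.src) (iterBlockOf (K - n) b.src) : ℝ))) with hM
  have h2' : c₀ * ‖v‖ ^ 2 ≤ (c₀ * ((c₀ / c₁) * Cg ^ 2 * M * ‖(frobEquiv.symm Z : W₂)‖)) * ‖v‖ := by
    have e : (c₀ * (Real.sqrt c₁)⁻¹ * Cg * ‖v‖) * (c₀ * (Real.sqrt c₁)⁻¹ * Cg * ‖(frobEquiv.symm Z : W₂)‖) * ((mB ^ 2 / 2 - 3 * ((Real.sqrt (max 2 (16 * c₀ * ((F.L : ℝ) ^ (K - n)) ^ 3 / (a * c₁))) * (2 + Real.sqrt (max 2 (16 * c₀ * ((F.L : ℝ) ^ (K - n)) ^ 3 / (a * c₁)))))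
          * (Real.sqrt 3 * (eta F n K)⁻¹ * (Real.exp (μ' * eta F n K) - 1) + (Real.sqrt 3 * (eta F n K)⁻¹ * (Real.exp (μ' * eta F n K) - 1)) ^ 2 + Real.sqrt a * CT * (Real.exp (3 * μ') - 1) + a * CT ^ 2 * (Real.exp (3 * μ') - 1) ^ 2)
          * (8 * Real.sqrt (max 2 (16 * c₀ * ((F.L : ℝ) ^ (K - n)) ^ 3 / (a * c₁))) + 8 * Real.sqrt (max 2 (16 * c₀ * ((F.L : ℝ) ^ (K - n)) ^ 3 / (a * c₁))) ^ 2)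
          * (CT * (1 + (Real.exp (3 * μ') - 1))) + CG * (CT * (Real.exp (3 * μ') - 1))) ^ 2)⁻¹ * Real.exp (9 * μ'))
        * (4 * (2 * (1 + 1 / (κ - μ'))) ^ 3) ^ 2
        * Real.exp (-(μ' * (Site.tdist (P := F.P K) (iterBlockOf (K - n) bd.src) (iterBlockOf (K - n) b.src) : ℝ)))
        = (c₀ * ((c₀ / c₁) * Cg ^ 2 * M * ‖(frobEquiv.symm Z : W₂)‖)) * ‖v‖ := by
      have hs : ((Real.sqrt c₁)⁻¹) ^ 2 = c₁⁻¹ := by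
        rw [inv_pow, Real.sq_sqrt hc₁.le]
      rw [hM, div_eq_mul_inv c₀ c₁, ← hs]; ring
    rw [← e]; exact h2
  by_cases hv0 : ‖v‖ = 0
  · rw [hv0]; exact hK0
  · have hvpos : 0 < ‖v‖ := lt_of_le_of_ne (norm_nonneg _) (Ne.symm hv0)
    have h4 : c₀ * ‖v‖ ≤ c₀ * ((c₀ / c₁) * Cg ^ 2 * M * ‖(frobEquiv.symm Z : W₂)‖) := by
      have := h2'
      rw [sq, ← mul_assoc] at this
      exact le_of_mul_le_mul_right this hvpos
    have h5 : ‖v‖ ≤ (c₀ / c₁) * Cg ^ 2 * M * ‖(frobEquiv.symm Z : W₂)‖ := le_of_mul_le_mul_left h4 hc₀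
    calc ‖v‖ ≤ (c₀ / c₁) * Cg ^ 2 * M * ‖(frobEquiv.symm Z : W₂)‖ := h5
      _ = _ := by rw [hM]; ring

end Summit.QuantumFields.YangMills.Theorems.Prop7ComplementaryProjectorGradientKernel

end
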